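import Summits.AnomalousDissipation.AnomalousDissipation.Theorems.CoherentFractionInvariantExtremeClimatesPlanar.Negative.OrbitProbe
import Literature.Analysis.FunctionSpaces.TorusSobolevNormProofs
import HarnessLib

/-!
# Extremality of the orbit climate (negative lane of
# `CoherentFraction.InvariantExtremeClimatesPlanar`, stmt-AnomalousDissipation-28074, block C2)

The orbit climate `orbMeasure = orb_* Haar(𝕋²)` of the crossed-shear root is an **extreme point**
of the climate class `{ρ prob. : ‖∇v‖² ≤ R₀ a.s., ∫ N_{c_K e₁ + h}(v, Φ) dρ = 0 ∀ h ⊥ e₁ ∀ Φ}`.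
Proof: a component `ρ` of a proper convex combination equal to `orbMeasure` is `≪ orbMeasure`;
its density pulled back to `𝕋²`, `R(σ) = (dρ/dμ)(orb σ)`, is integrable with `∫ R = 1`, is
invariant under the half-period shift `(½, 0)` (the orbit map is), and — testing the
stationarity of `ρ` against the probe functionals `Φ_{j,l,w}` of block C1 with `h = (2j, 0, l)` —
has `∫ R e_{(2j,l)} = 0` for all `(j,l) ≠ 0`; with the shift invariance all Fourier
coefficients of `R` except the zeroth vanish, so `R = 1` a.e. (Fourier uniqueness on `𝕋²`)
and `ρ = orbMeasure`. [folklore]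
-/

noncomputable section

set_option linter.dupNamespace false

namespace Summit.AnomalousDissipation.AnomalousDissipation.Theorems.CrossedShearOrbit

open Real MeasureTheory Filter Topology Set
open scoped InnerProductSpace ENNReal ComplexConjugate
open Literature.Analysis.FunctionSpaces Literature.Analysis.FunctionSpaces.Torus Literature.Analysis.FluidPDE
open Literature.Analysis.FluidPDE.Torus
open Summit.AnomalousDissipation.AnomalousDissipation.Theorems.CrossedShearRoot
open UnitAddTorus (mFourier mFourierCoeff)

local notation "𝕋³" => UnitAddTorus (Fin 3)
local notation "𝕋²" => UnitAddTorus (Fin 2)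
local notation "E³" => EuclideanSpace ℝ (Fin 3)
local notation "E²" => EuclideanSpace ℝ (Fin 2)
local notation "H" => energySpace (Fin 3)

/-! ## The half-period shift -/

/-- The half-period shift `τ = (½, 0)` of the parameter torus. [folklore] -/
def halfShift : 𝕋² := fun i => if i = 0 then (((1 / 2 : ℝ) : UnitAddCircle)) else 0

/-- `c4` has period `½`. [folklore] -/
theorem c4_add_half (t : ℝ) : c4 (t + 1 / 2) = c4 t := by
  simp only [c4]
  rw [show 4 * π * (t + 1 / 2) = 4 * π * t + 2 * π by ring, Real.cos_add_two_pi]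

/-- The root field is invariant under the translation `hvec τ = (½, 0, 0)`. [folklore] -/
theorem vfield_add_hvec_halfShift (x : 𝕋³) : vfield (x + hvec halfShift) = vfield x := by
  set a₀ : E³ := WithLp.toLp 2 ![(1 / 2 : ℝ), 0, 0] with ha₀
  have ha : hvec halfShift = proj a₀ := by
    funext i
    fin_cases i <;> simp [hvec, halfShift, ha₀, proj]
  obtain ⟨y, rfl⟩ : ∃ y, proj y = x := ⟨repr x, proj_repr x⟩
  rw [ha, ← proj_add]
  have h1 := congrFun lift_vfield (y + a₀)
  have h2 := congrFun lift_vfield y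
  rw [lift_apply] at h1 h2
  rw [h1, h2]
  have hc : ∀ t : ℝ, c4 (t + 2⁻¹) = c4 t := fun t => by
    rw [← one_div]
    exact c4_add_half t
  simp [ha₀, hc]

/-- **The orbit map is invariant under the half-period shift**: `orb (σ + τ) = orb σ`. [folklore] -/
theorem orb_add_halfShift (σ : 𝕋²) : orb (σ + halfShift) = orb σ := by
  have h : orbC (σ + halfShift) = orbC σ := by
    refine ContinuousMap.ext fun x => ?_
    rw [orbC_apply, orbC_apply, vshift_apply, vshift_apply, hvec_add, ← add_assoc,
      vfield_add_hvec_halfShift]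
  apply Subtype.ext
  show orbLp (σ + halfShift) = orbLp σ
  unfold orbLp
  rw [h]

/-- Characters at the half-period shift: `e_q(τ) = -1` when `q₀` is odd. [folklore] -/
theorem mFourier_halfShift_of_odd {q : Fin 2 → ℤ} (hq : Odd (q 0)) : mFourier q halfShift = -1 := by
  obtain ⟨m, hm⟩ := hq
  have h0 : halfShift 0 = ((1 / 2 : ℝ) : UnitAddCircle) := by simp [halfShift]
  have h1 : halfShift 1 = 0 := by simp [halfShift]
  simp only [mFourier, ContinuousMap.coe_mk, Fin.prod_univ_two, h0, h1, fourier_coe_apply,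
    fourier_eval_zero, mul_one]
  have e : (2 : ℂ) * π * Complex.I * ((q 0 : ℤ) : ℂ) * ((1 / 2 : ℝ) : ℂ) / ((1 : ℝ) : ℂ) =
      (m : ℂ) * (2 * π * Complex.I) + π * Complex.I := by
    rw [hm]
    push_cast
    ring
  rw [e, Complex.exp_add, Complex.exp_int_mul_two_pi_mul_I, Complex.exp_pi_mul_I]
  simp

/-! ## Pull-back of an absolutely continuous probability measure along the orbit -/

variable {ρ : Measure H}

/-- The pulled-back density `R(σ) = (dρ/dμ)(orb σ)`. [folklore] -/
def dens (ρ : Measure H) (σ : 𝕋²) : ℝ := (ρ.rnDeriv orbMeasure (orb σ)).toReal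

/-- `R` is measurable. [folklore] -/
theorem measurable_dens (ρ : Measure H) : Measurable (dens ρ) :=
  ((Measure.measurable_rnDeriv ρ orbMeasure).comp measurable_orb).ennreal_toReal

/-- `R` is invariant under the half-period shift. [folklore] -/
theorem dens_add_halfShift (ρ : Measure H) (σ : 𝕋²) : dens ρ (σ + halfShift) = dens ρ σ := by
  show (ρ.rnDeriv orbMeasure (orb (σ + halfShift))).toReal = _
  rw [orb_add_halfShift]
  rfl

/-- Change of variables: `∫ f dρ = ∫ R(σ) f(orb σ) dσ` for `ρ ≪ μ` and continuous `f`. [folklore] -/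
theorem integral_eq_integral_dens_mul [IsProbabilityMeasure ρ] (hac : ρ ≪ orbMeasure) {f : H → ℝ}
    (hf : Continuous f) :
    ∫ v, f v ∂ρ = ∫ σ, dens ρ σ * f (orb σ) := by
  have h1 : ∫ v, f v ∂ρ = ∫ v, (ρ.rnDeriv orbMeasure v).toReal • f v ∂orbMeasure :=
    (integral_rnDeriv_smul hac).symm
  have hmeas : AEStronglyMeasurable (fun v => (ρ.rnDeriv orbMeasure v).toReal • f v) orbMeasure :=
    ((Measure.measurable_rnDeriv ρ orbMeasure).ennreal_toReal.aestronglyMeasurable.smul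
      hf.aestronglyMeasurable)
  have h2 : ∫ v, (ρ.rnDeriv orbMeasure v).toReal • f v ∂orbMeasure =
      ∫ σ, (ρ.rnDeriv orbMeasure (orb σ)).toReal • f (orb σ) := by
    have := integral_map (μ := (volume : Measure 𝕋²)) measurable_orb.aemeasurable
      (f := fun v => (ρ.rnDeriv orbMeasure v).toReal • f v) (by simpa [orbMeasure] using hmeas)
    simpa [orbMeasure] using this
  rw [h1, h2]
  rfl

/-- `∫ R = 1` for a probability measure `ρ ≪ μ`. [folklore] -/
theorem integral_dens [IsProbabilityMeasure ρ] (hac : ρ ≪ orbMeasure) : ∫ σ, dens ρ σ = 1 := by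
  have h := integral_eq_integral_dens_mul hac (f := fun _ => (1 : ℝ)) continuous_const
  simp only [integral_const, probReal_univ, smul_eq_mul, mul_one] at h
  exact h.symm

/-- `R` is integrable. [folklore] -/
theorem integrable_dens (ρ : Measure H) [IsProbabilityMeasure ρ] : Integrable (dens ρ) volume := by
  refine integrable_toReal_of_lintegral_ne_top
    ((Measure.measurable_rnDeriv ρ orbMeasure).comp measurable_orb).aemeasurable ?_
  have h : ∫⁻ σ, ρ.rnDeriv orbMeasure (orb σ) = ∫⁻ v, ρ.rnDeriv orbMeasure v ∂orbMeasure := by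
    rw [orbMeasure, lintegral_map (Measure.measurable_rnDeriv ρ (Measure.map orb volume)) measurable_orb]
  rw [h]
  exact (Measure.lintegral_rnDeriv_lt_top ρ orbMeasure).ne

/-- **Pulled-back stationarity**: if `ρ ≪ μ` annihilates the route integrand for a horizontal `h`,
then `∫ R(σ) (orb σ, (h·∇)Φ'(orb σ)) dσ = 0`. [folklore] -/
theorem integral_dens_mul_driftTerm [IsProbabilityMeasure ρ] (hac : ρ ≪ orbMeasure) {h : E³}
    (Φ : CylindricalTest (Fin 3))
    (hstat : ∫ v, routeIntegrand drift h Φ v ∂ρ = 0) :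
    ∫ σ, dens ρ σ * driftTerm h Φ (orb σ) = 0 := by
  have hae : ∀ᵐ v ∂ρ, routeIntegrand drift h Φ v = driftTerm h Φ v :=
    hac.ae_le (ae_orbMeasure_of_forall (P := fun v => routeIntegrand drift h Φ v = driftTerm h Φ v)
      (fun s => routeIntegrand_orb h Φ s))
  rw [← integral_eq_integral_dens_mul hac (continuous_driftTerm h Φ), ← integral_congr_ae hae, hstat]

/-! ## Fourier coefficients of the pulled-back density -/

/-- The complexified density. [folklore] -/
def densC (ρ : Measure H) (σ : 𝕋²) : ℂ := (dens ρ σ : ℂ)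

/-- `R e_p` is integrable. [folklore] -/
theorem integrable_densC_mul_mFourier (ρ : Measure H) [IsProbabilityMeasure ρ] (p : Fin 2 → ℤ) :
    Integrable (fun σ : 𝕋² => densC ρ σ * mFourier p σ) volume := by
  refine ((integrable_dens ρ).ofReal.mul_bdd (c := 1) (mFourier p).continuous.aestronglyMeasurable
    (Filter.Eventually.of_forall fun σ => ?_))
  exact ((mFourier p).norm_coe_le_norm σ).trans_eq UnitAddTorus.mFourier_norm

/-- The Fourier coefficients of `R` as integrals `∫ R e_{-q}`. [folklore] -/
theorem mFourierCoeff_densC (ρ : Measure H) (q : Fin 2 → ℤ) :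
    mFourierCoeff (densC ρ) q = ∫ σ, densC ρ σ * mFourier (-q) σ := by
  rw [mFourierCoeff_eq_integral_volume]
  simp only [smul_eq_mul, mul_comm]

/-- **Odd first frequency**: `𝓕R(q) = 0` when `q₀` is odd (half-period invariance). [folklore] -/
theorem mFourierCoeff_densC_of_odd (ρ : Measure H) {q : Fin 2 → ℤ} (hq : Odd (q 0)) :
    mFourierCoeff (densC ρ) q = 0 := by
  rw [mFourierCoeff_densC]
  set J := ∫ σ, densC ρ σ * mFourier (-q) σ with hJ
  have hshift : J = ∫ σ, densC ρ (σ + halfShift) * mFourier (-q) (σ + halfShift) :=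
    (integral_add_right_eq_self (μ := (volume : Measure 𝕋²))
      (fun σ => densC ρ σ * mFourier (-q) σ) halfShift).symm
  have hodd : Odd ((-q) 0) := by simpa using hq.neg
  have e : ∀ σ, densC ρ (σ + halfShift) * mFourier (-q) (σ + halfShift) =
      -(densC ρ σ * mFourier (-q) σ) := by
    intro σ
    rw [densC, dens_add_halfShift, mFourier_apply_add, mFourier_halfShift_of_odd hodd, densC]
    ring
  simp_rw [e, integral_neg] at hshift
  have : (2 : ℂ) * J = 0 := by rw [two_mul]; nth_rewrite 2 [hshift]; ring
  simpa using this

/-- The horizontal direction `h_P = (P₀, 0, P₁)` used to probe the frequency `P`. [folklore] -/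
def hdir (P : Fin 2 → ℤ) : E³ := WithLp.toLp 2 ![((P 0 : ℤ) : ℝ), 0, ((P 1 : ℤ) : ℝ)]

/-- `h_P ⊥ e₁`. [folklore] -/
theorem hdir_apply_one (P : Fin 2 → ℤ) : hdir P 1 = 0 := by
  simp [hdir]

/-- `h_P` is horizontal in the route's sense. [folklore] -/
theorem inner_hdir_single (P : Fin 2 → ℤ) : ⟪hdir P, EuclideanSpace.single (1 : Fin 3) (1 : ℝ)⟫_ℝ = 0 := by
  rw [EuclideanSpace.inner_single_right, hdir_apply_one]
  simp

/-- `θ(P, h̄_P) = P₀² + P₁²`. [folklore] -/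
theorem theta_hdir (P : Fin 2 → ℤ) : theta P (hbar (hdir P)) = ((P 0 : ℤ) : ℝ) ^ 2 + ((P 1 : ℤ) : ℝ) ^ 2 := by
  simp [theta, hbar, hdir, Fin.sum_univ_two]
  ring

/-- `θ(P, h̄_P) ≠ 0` for `P ≠ 0`. [folklore] -/
theorem theta_hdir_ne_zero {P : Fin 2 → ℤ} (hP : P ≠ 0) : theta P (hbar (hdir P)) ≠ 0 := by
  rw [theta_hdir]
  intro h0
  apply hP
  have h0' : ((P 0 : ℤ) : ℝ) = 0 ∧ ((P 1 : ℤ) : ℝ) = 0 := by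
    constructor <;> nlinarith [sq_nonneg ((P 0 : ℤ) : ℝ), sq_nonneg ((P 1 : ℤ) : ℝ)]
  funext i
  fin_cases i
  · exact_mod_cast h0'.1
  · exact_mod_cast h0'.2

/-- `∫ R(σ) Re(K e_P(σ)) dσ = Re(K ∫ R e_P)`. [folklore] -/
theorem integral_dens_mul_re (ρ : Measure H) [IsProbabilityMeasure ρ] (K : ℂ) (P : Fin 2 → ℤ) :
    ∫ σ, dens ρ σ * (K * mFourier P σ).re = (K * ∫ σ, densC ρ σ * mFourier P σ).re := by
  have h := integral_re ((integrable_densC_mul_mFourier ρ P).const_mul K)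
  simp only [RCLike.re_to_complex] at h
  rw [integral_const_mul] at h
  rw [← h]
  refine integral_congr_ae (Filter.Eventually.of_forall fun σ => ?_)
  simp only [densC, Complex.mul_re, Complex.mul_im, Complex.ofReal_re, Complex.ofReal_im]
  ring

/-- **Probed frequencies**: for `(j,l)` with `P = (2j,l) ≠ 0`, stationarity of `ρ ≪ μ` against the
probe functionals `Φ_{j,l,1}`, `Φ_{j,l,-i}` with `h = h_P` forces `∫ R e_P = 0`. [folklore] -/
theorem integral_densC_mul_mFourier_eq_zero [IsProbabilityMeasure ρ] (hac : ρ ≪ orbMeasure)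
    (hstat : ∀ h : E³, ⟪h, EuclideanSpace.single (1 : Fin 3) (1 : ℝ)⟫_ℝ = 0 →
      ∀ Φ : CylindricalTest (Fin 3), ∫ v, routeIntegrand drift h Φ v ∂ρ = 0)
    (j l : ℤ) (hP : Pfreq j l ≠ 0) :
    ∫ σ, densC ρ σ * mFourier (Pfreq j l) σ = 0 := by
  set P := Pfreq j l with hPdef
  set J := ∫ σ, densC ρ σ * mFourier P σ with hJ
  set c : ℂ := (Gam j l : ℂ) * (2 * π * Complex.I * (theta P (hbar (hdir P)) : ℝ)) with hc
  have hc0 : c ≠ 0 := by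
    rw [hc]
    refine mul_ne_zero (by exact_mod_cast Gam_ne_zero j l) (mul_ne_zero (mul_ne_zero (mul_ne_zero
      two_ne_zero (by exact_mod_cast Real.pi_ne_zero)) Complex.I_ne_zero) ?_)
    exact_mod_cast theta_hdir_ne_zero hP
  -- stationarity against `Φ_{j,l,w}` gives `Re(w c J) = 0`
  have key : ∀ w : ℂ, (w * c * J).re = 0 := by
    intro w
    have h0 := integral_dens_mul_driftTerm hac (probe j l w) (hstat (hdir P) (inner_hdir_single P) _)
    simp_rw [driftTerm_probe_orb j l w (hdir_apply_one P), mul_neg, integral_neg, neg_eq_zero] at h0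
    have e : ∀ σ, (w * ((Gam j l : ℂ) * mFourier (Pfreq j l) σ) *
        (2 * π * Complex.I * (theta (Pfreq j l) (hbar (hdir P)) : ℝ))).re = ((w * c) * mFourier P σ).re := by
      intro σ
      rw [hc, hPdef]
      ring_nf
    simp_rw [e, integral_dens_mul_re ρ] at h0
    rwa [← hJ] at h0
  have h1 := key 1
  have h2 := key (-Complex.I)
  have hcJ : c * J = 0 := by
    apply Complex.ext
    · simpa using h1
    · have : (-Complex.I * (c * J)).re = (c * J).im := by simp [Complex.mul_re]
      rw [← this]
      simpa [mul_assoc] using h2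
  exact (mul_eq_zero.1 hcJ).resolve_left hc0

/-- **All nonzero Fourier coefficients of `R` vanish.** [folklore] -/
theorem mFourierCoeff_densC_eq_zero [IsProbabilityMeasure ρ] (hac : ρ ≪ orbMeasure)
    (hstat : ∀ h : E³, ⟪h, EuclideanSpace.single (1 : Fin 3) (1 : ℝ)⟫_ℝ = 0 →
      ∀ Φ : CylindricalTest (Fin 3), ∫ v, routeIntegrand drift h Φ v ∂ρ = 0)
    {q : Fin 2 → ℤ} (hq : q ≠ 0) : mFourierCoeff (densC ρ) q = 0 := by
  rcases Int.even_or_odd (q 0) with hev | hodd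
  · obtain ⟨m, hm⟩ := hev
    have hP : Pfreq (-m) (-(q 1)) = -q := by
      funext i
      fin_cases i
      · simp [Pfreq, hm]
        ring
      · simp [Pfreq]
    have hP0 : Pfreq (-m) (-(q 1)) ≠ 0 := by
      rw [hP]
      exact neg_ne_zero.2 hq
    rw [mFourierCoeff_densC, ← hP]
    exact integral_densC_mul_mFourier_eq_zero hac hstat _ _ hP0
  · exact mFourierCoeff_densC_of_odd ρ hodd

/-- The zeroth Fourier coefficient of `R` is `1`. [folklore] -/
theorem mFourierCoeff_densC_zero [IsProbabilityMeasure ρ] (hac : ρ ≪ orbMeasure) :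
    mFourierCoeff (densC ρ) 0 = 1 := by
  rw [mFourierCoeff_densC, neg_zero]
  have e : ∀ σ : 𝕋², densC ρ σ * mFourier 0 σ = ((dens ρ σ : ℝ) : ℂ) := by
    intro σ
    simp [UnitAddTorus.mFourier_zero, densC]
  simp_rw [e]
  rw [integral_complex_ofReal, integral_dens hac]
  simp

/-- Fourier coefficients of the constant `1` on `𝕋²`. [folklore] -/
theorem mFourierCoeff_one_fin_two (q : Fin 2 → ℤ) :
    mFourierCoeff (fun _ : 𝕋² => (1 : ℂ)) q = if q = 0 then 1 else 0 := by
  have h1 : (fun _ : 𝕋² => (1 : ℂ)) = trigPoly ({0} : Finset (Fin 2 → ℤ)) (fun _ => (1 : ℂ)) := by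
    funext x
    simp [trigPoly_apply, UnitAddTorus.mFourier_zero]
  rw [h1, mFourierCoeff_trigPoly]
  simp

/-- **The pulled-back density is `1` a.e.** [folklore] -/
theorem dens_ae_eq_one [IsProbabilityMeasure ρ] (hac : ρ ≪ orbMeasure)
    (hstat : ∀ h : E³, ⟪h, EuclideanSpace.single (1 : Fin 3) (1 : ℝ)⟫_ℝ = 0 →
      ∀ Φ : CylindricalTest (Fin 3), ∫ v, routeIntegrand drift h Φ v ∂ρ = 0) :
    ∀ᵐ σ : 𝕋², dens ρ σ = 1 := by
  have hC : densC ρ =ᵐ[volume] fun _ => (1 : ℂ) := by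
    refine Torus.ae_eq_of_forall_mFourierCoeff_eq (integrable_dens ρ).ofReal
      (continuous_const.integrable_unitAddTorus) fun q => ?_
    rw [mFourierCoeff_one_fin_two]
    split_ifs with hq
    · rw [hq, mFourierCoeff_densC_zero hac]
    · exact mFourierCoeff_densC_eq_zero hac hstat hq
  filter_upwards [hC] with σ hσ
  simp only [densC] at hσ
  exact_mod_cast hσ

/-! ## Extremality -/

/-- **Rigidity**: a probability measure `ρ ≪ orbMeasure` that is stationary for all horizontal
drifts against all cylindrical functionals equals `orbMeasure`. [folklore] -/
theorem eq_orbMeasure_of_absolutelyContinuous [IsProbabilityMeasure ρ] (hac : ρ ≪ orbMeasure)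
    (hstat : ∀ h : E³, ⟪h, EuclideanSpace.single (1 : Fin 3) (1 : ℝ)⟫_ℝ = 0 →
      ∀ Φ : CylindricalTest (Fin 3), ∫ v, routeIntegrand drift h Φ v ∂ρ = 0) :
    ρ = orbMeasure := by
  have h1 : ∀ᵐ σ : 𝕋², ρ.rnDeriv orbMeasure (orb σ) = 1 := by
    filter_upwards [dens_ae_eq_one hac hstat] with σ hσ
    exact (ENNReal.toReal_eq_one_iff _).1 hσ
  have h2 : ∀ᵐ v ∂orbMeasure, ρ.rnDeriv orbMeasure v = 1 := by
    rw [orbMeasure] at h1 ⊢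
    exact (ae_map_iff measurable_orb.aemeasurable
      (Measure.measurable_rnDeriv _ _ (measurableSet_singleton 1))).2 h1
  calc ρ = orbMeasure.withDensity (ρ.rnDeriv orbMeasure) := (Measure.withDensity_rnDeriv_eq _ _ hac).symm
    _ = orbMeasure.withDensity 1 := withDensity_congr_ae h2
    _ = orbMeasure := withDensity_one

/-- **The orbit climate is an extreme point of the climate class** `𝒞̄(c_K e₁, R₀)`. [folklore] -/
theorem orbMeasure_mem_extremePoints : orbMeasure ∈ (climateClass drift R0).extremePoints ℝ≥0∞ := by
  refine mem_extremePoints.2 ⟨orbMeasure_mem_climateClass, fun ρ₁ h₁ ρ₂ h₂ hseg => ?_⟩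
  have key : ∀ {ρ₁ ρ₂ : Measure H}, ρ₁ ∈ climateClass drift R0 →
      orbMeasure ∈ openSegment ℝ≥0∞ ρ₁ ρ₂ → ρ₁ = orbMeasure := by
    intro ρ₁ ρ₂ h₁ hseg
    obtain ⟨a, b, ha, hb, hab, hsum⟩ := hseg
    haveI := h₁.1
    have hle : a • ρ₁ ≤ orbMeasure := by
      rw [← hsum]
      exact Measure.le_add_right le_rfl
    have hac : ρ₁ ≪ orbMeasure :=
      (Measure.absolutelyContinuous_smul ha.ne').trans (Measure.absolutelyContinuous_of_le hle)
    exact eq_orbMeasure_of_absolutelyContinuous hac h₁.2.2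
  exact ⟨key h₁ hseg, key h₂ (openSegment_symm ℝ≥0∞ ρ₁ ρ₂ ▸ hseg)⟩

end Summit.AnomalousDissipation.AnomalousDissipation.Theorems.CrossedShearOrbit

end
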